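import Literature.Analysis.FluidPDE.PoincareHomotopyOperator
import Mathlib.Analysis.SpecialFunctions.Integrals.Basic
import Mathlib.MeasureTheory.Integral.MeanInequalities
import Mathlib.MeasureTheory.Measure.Lebesgue.EqHaar
import HarnessLib

/-!
# The cone potential on `L²_loc(ℝ³)`: measurability, the `L²(B_R)` bound, scaling

Analysis/FluidPDE proofs file (no new definitions) over `PoincareHomotopyOperator.lean`
(`Literature.Analysis.FluidPDE.conePotential f x = ∫₀¹ t f(tx) × x dt`, the vector potential of
Fonda 2018, Thm. 3.31). The potential is used for fields `f ∈ L²_loc(ℝ³; ℝ³)` (the discretely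
self-similar data of Bradshaw–Tsai 2019, Lemma 4.1); this file supplies the measure theory:

* `aestronglyMeasurable_comp_smul_prod`: `(t, x) ↦ f(t x)` is a.e.-strongly measurable on
  `(0, ∞) × ℝ³` for a.e.-strongly measurable `f` (the dilations `x ↦ t x`, `t ≠ 0`, are
  non-singular for Lebesgue measure);
* `lintegral_ball_comp_smul`: `∫_{B_R} G(t y) dy = t⁻³ ∫_{B_{tR}} G` (`t > 0`);
* **the `L²(B_R)` bound** `lintegral_ball_coneMajorant_sq_le`:
  `∫_{B_R} (∫₀¹ ‖t f(tx) × x‖ dt)² dx ≤ 4 R² ∫_{B_R} ‖f‖²`, by Cauchy–Schwarz in `t` with the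
  weights `t^{∓1/4}` (`(∫₀¹ t |x| |f(tx)| dt)² ≤ (∫₀¹ t^{-1/2} dt) ∫₀¹ t^{5/2} |x|² |f(tx)|² dt`),
  Tonelli, and the scaling `∫_{B_R} |x|²|f(tx)|² dx ≤ R² t⁻³ ∫_{B_{tR}} |f|² ≤ R² t⁻³ ∫_{B_R} |f|²`
  for `t ≤ 1` (`∫₀¹ t^{-1/2} dt = 2`); hence `∫_{B_R} ‖conePotential f‖² ≤ 4R² ∫_{B_R} ‖f‖²`
  (`lintegral_ball_enorm_conePotential_sq_le`) and the a.e. integrability of the cone integrand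
  for `f ∈ L²_loc` (`ae_integrableOn_coneIntegrand`), with the a.e. linearity
  `conePotential (f − g) = conePotential f − conePotential g`;
* `aestronglyMeasurable_conePotential`;
* **scaling covariance** `conePotential_smul_of_dss`: if `c f(c x) = f(x)` for all `x` (`c ≠ 0`)
  then `conePotential f (c x) = conePotential f x` (the potential of a `c`-DSS field is
  `0`-homogeneous along the scaling orbit), and its `zpow` iterate.

## Relation to the tree's homotopy operator on forms

`Literature/Geometry/Kaehler/PoincareLemmaFlat.lean` has the radial homotopy operator on smooth
`(k+1)`-forms over any normed space (`Literature.Geometry.Kaehler.coneIntegrand` /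
`Literature.Geometry.Kaehler.coneOperator`, homotopy formula `extDeriv_coneOperator_add`), for
`ContDiff ℝ ∞` forms. The vector-language `Literature.Analysis.FluidPDE.conePotential` of
`PoincareHomotopyOperator.lean` is its `k = 1`, `E = ℝ³` instance under the dictionary
`f ↔ f ⌟ vol` (not in the tree); it is kept separate because the fluid application needs `C¹`
fields and, in this file, merely measurable `L²_loc` fields, for which the operator is handled
through Lebesgue integrals rather than smooth forms. (The short name `coneIntegrand` thus exists in
both namespaces, with different types.)

## References

* A. Fonda, *The Kurzweil–Henstock Integral for Undergraduates* (2018), Thm. 3.31 [Fonda2018].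
* Z. Bradshaw, T.-P. Tsai, Analysis & PDE 12 (2019) = arXiv:1801.08060, Lemma 4.1 and (3.6)
  (scaling of local `L²` masses of DSS fields) [BradshawTsai2019].
-/

noncomputable section

open MeasureTheory Set Function Filter Topology InnerProductSpace intervalIntegral Metric Module
open scoped RealInnerProductSpace ENNReal NNReal

namespace Literature.Analysis.FluidPDE

/-- Local notation for physical space `ℝ³ = EuclideanSpace ℝ (Fin 3)`. -/
local notation "ℝ³" => EuclideanSpace ℝ (Fin 3)

/-! ## Measurability of `(t, x) ↦ f(t x)` -/

section Measurability

variable {F : Type*} [NormedAddCommGroup F]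

/-- For `t ≠ 0` the dilation `x ↦ t x` of `ℝ³` pulls Lebesgue-null sets back to null sets, so
`x ↦ f(t x)` is a.e.-strongly measurable with `f`. [folklore] -/
theorem aestronglyMeasurable_comp_smul {f : ℝ³ → F} (hf : AEStronglyMeasurable f volume) {t : ℝ}
    (ht : t ≠ 0) : AEStronglyMeasurable (fun x : ℝ³ => f (t • x)) volume :=
  hf.comp_quasiMeasurePreserving (Measure.quasiMeasurePreserving_smul volume ht)

/-- **Joint measurability of `(t, x) ↦ f(t x)` on `(0, ∞) × ℝ³`** for an a.e.-strongly measurable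
`f : ℝ³ → F`: if `f = g` off a null set `N` with `g` strongly measurable, then `f(tx) = g(tx)` off
`{(t, x) : t x ∈ N}`, whose `t`-slices `t⁻¹ N` are null for `t > 0`. [folklore] -/
theorem aestronglyMeasurable_comp_smul_prod {f : ℝ³ → F} (hf : AEStronglyMeasurable f volume) :
    AEStronglyMeasurable (fun p : ℝ × ℝ³ => f (p.1 • p.2))
      ((volume.restrict (Ioi (0 : ℝ))).prod (volume : Measure ℝ³)) := by
  set g := hf.mk f with hg_def
  have hg : StronglyMeasurable g := hf.stronglyMeasurable_mk
  have hsm : Measurable fun p : ℝ × ℝ³ => p.1 • p.2 := measurable_fst.smul measurable_snd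
  have hmeas : AEStronglyMeasurable (fun p : ℝ × ℝ³ => g (p.1 • p.2))
      ((volume.restrict (Ioi (0 : ℝ))).prod (volume : Measure ℝ³)) :=
    (hg.comp_measurable hsm).aestronglyMeasurable
  refine hmeas.congr ?_
  -- the exceptional set
  set N : Set ℝ³ := toMeasurable volume {y | f y ≠ g y} with hN
  have hNnull : volume N = 0 := by
    rw [hN, measure_toMeasurable]
    exact hf.ae_eq_mk
  have hNm : MeasurableSet N := measurableSet_toMeasurable _ _
  set S : Set (ℝ × ℝ³) := (fun p : ℝ × ℝ³ => p.1 • p.2) ⁻¹' N with hS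
  have hSm : MeasurableSet S := hNm.preimage hsm
  have hSnull : ((volume.restrict (Ioi (0 : ℝ))).prod (volume : Measure ℝ³)) S = 0 := by
    rw [Measure.prod_apply hSm]
    have hslice : ∀ t ∈ Ioi (0 : ℝ), (volume : Measure ℝ³) (Prod.mk t ⁻¹' S) = 0 := by
      intro t ht
      have hpre : Prod.mk t ⁻¹' S = (fun x : ℝ³ => t • x) ⁻¹' N := rfl
      rw [hpre, Measure.addHaar_preimage_smul volume (ne_of_gt ht), hNnull, mul_zero]
    rw [setLIntegral_congr_fun measurableSet_Ioi hslice, lintegral_zero]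
  rw [Filter.EventuallyEq, ae_iff]
  refine measure_mono_null (fun p hp => ?_) hSnull
  simp only [mem_setOf_eq] at hp
  show p.1 • p.2 ∈ N
  exact subset_toMeasurable _ _ (Ne.symm hp)

/-- The same on `(0, 1] × ℝ³`. [folklore] -/
theorem aestronglyMeasurable_comp_smul_prod_Ioc {f : ℝ³ → F} (hf : AEStronglyMeasurable f volume) :
    AEStronglyMeasurable (fun p : ℝ × ℝ³ => f (p.1 • p.2))
      ((volume.restrict (Ioc (0 : ℝ) 1)).prod (volume : Measure ℝ³)) :=
  (aestronglyMeasurable_comp_smul_prod hf).mono_measure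
    (Measure.prod_mono (Measure.restrict_mono Ioc_subset_Ioi_self le_rfl) le_rfl)

/-- Joint a.e.-strong measurability of the cone integrand `(t, x) ↦ t f(tx) × x` on
`(0, 1] × ℝ³`. [folklore] -/
theorem aestronglyMeasurable_coneIntegrand_prod {f : ℝ³ → ℝ³}
    (hf : AEStronglyMeasurable f volume) :
    AEStronglyMeasurable (uncurry (coneIntegrand f))
      ((volume.restrict (Ioc (0 : ℝ) 1)).prod (volume : Measure ℝ³)) := by
  have h1 := aestronglyMeasurable_comp_smul_prod_Ioc hf
  have h2 : AEStronglyMeasurable (fun p : ℝ × ℝ³ => cross (f (p.1 • p.2)) p.2)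
      ((volume.restrict (Ioc (0 : ℝ) 1)).prod (volume : Measure ℝ³)) :=
    crossCLM.aestronglyMeasurable_comp₂ h1 measurable_snd.aestronglyMeasurable
  show AEStronglyMeasurable (fun p : ℝ × ℝ³ => p.1 • cross (f (p.1 • p.2)) p.2) _
  exact measurable_fst.aestronglyMeasurable.smul h2

end Measurability

/-! ## Scaling of integrals over balls -/

/-- Change of variables `x = t y` (`t > 0`) for the Lebesgue integral over balls of `ℝ³` centred at
the origin: `∫⁻_{B_R} G(t y) dy = t⁻³ ∫⁻_{B_{tR}} G(x) dx` (Mathlib `Measure.map_addHaar_smul`; this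
is the scaling behind Bradshaw–Tsai 2019, (3.6)). [cite: BradshawTsai2019, (3.6)] -/
theorem lintegral_ball_comp_smul (G : ℝ³ → ℝ≥0∞) {t : ℝ} (ht : 0 < t) (R : ℝ) :
    ∫⁻ y in ball (0 : ℝ³) R, G (t • y) =
      ENNReal.ofReal ((t ^ 3)⁻¹) * ∫⁻ x in ball (0 : ℝ³) (t * R), G x := by
  have ht0 : t ≠ 0 := ht.ne'
  have he : MeasurableEmbedding (fun x : ℝ³ => t • x) :=
    (Homeomorph.smul (isUnit_iff_ne_zero.2 ht0).unit).toMeasurableEquiv.measurableEmbedding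
  have hpre : (fun x : ℝ³ => t • x) ⁻¹' ball (0 : ℝ³) (t * R) = ball 0 R := by
    ext x
    simp only [mem_preimage, mem_ball_zero_iff, norm_smul, Real.norm_eq_abs, abs_of_pos ht]
    exact ⟨fun h => lt_of_mul_lt_mul_left h ht.le, fun h => mul_lt_mul_of_pos_left h ht⟩
  have h1 : ∫⁻ y in ball (0 : ℝ³) R, G (t • y) =
      ∫⁻ x in ball (0 : ℝ³) (t * R), G x ∂(Measure.map (fun x : ℝ³ => t • x) volume) := by
    rw [he.restrict_map, he.lintegral_map, hpre]
  rw [h1, Measure.map_addHaar_smul volume ht0, Measure.restrict_smul, lintegral_smul_measure,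
    finrank_euclideanSpace_fin, smul_eq_mul, abs_of_nonneg (by positivity)]

/-! ## Pointwise bounds -/

/-- `‖a × b‖ ≤ ‖a‖ ‖b‖`. [folklore] -/
theorem norm_cross_le (a b : ℝ³) : ‖cross a b‖ ≤ ‖a‖ * ‖b‖ := by
  rw [norm_cross]
  have h1 : Real.sin (InnerProductGeometry.angle a b) ≤ 1 := Real.sin_le_one _
  have h0 : 0 ≤ ‖a‖ * ‖b‖ := by positivity
  nlinarith

/-- `‖t f(tx) × x‖ₑ ≤ t ‖x‖ₑ ‖f(tx)‖ₑ` for `t ≥ 0`. [folklore] -/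
theorem enorm_coneIntegrand_le (f : ℝ³ → ℝ³) {t : ℝ} (ht : 0 ≤ t) (x : ℝ³) :
    ‖coneIntegrand f t x‖ₑ ≤ ENNReal.ofReal t * (‖x‖ₑ * ‖f (t • x)‖ₑ) := by
  have h : ‖coneIntegrand f t x‖ ≤ t * (‖x‖ * ‖f (t • x)‖) := by
    rw [coneIntegrand_apply, norm_smul, Real.norm_eq_abs, abs_of_nonneg ht]
    refine mul_le_mul_of_nonneg_left ?_ ht
    rw [mul_comm]
    exact norm_cross_le _ _
  calc ‖coneIntegrand f t x‖ₑ = ENNReal.ofReal ‖coneIntegrand f t x‖ := (ofReal_norm _).symm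
    _ ≤ ENNReal.ofReal (t * (‖x‖ * ‖f (t • x)‖)) := ENNReal.ofReal_le_ofReal h
    _ = ENNReal.ofReal t * (‖x‖ₑ * ‖f (t • x)‖ₑ) := by
        rw [ENNReal.ofReal_mul ht, ENNReal.ofReal_mul (norm_nonneg _), ofReal_norm,
          ofReal_norm]

/-- `‖conePotential f x‖ₑ ≤ ∫₀¹ ‖t f(tx) × x‖ₑ dt` (always; the junk value `0` obeys it too). [folklore] -/
theorem enorm_conePotential_le (f : ℝ³ → ℝ³) (x : ℝ³) :
    ‖conePotential f x‖ₑ ≤ ∫⁻ t in Ioc (0 : ℝ) 1, ‖coneIntegrand f t x‖ₑ := by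
  rw [conePotential_eq_setIntegral]
  exact enorm_integral_le_lintegral_enorm _

/-! ## The weight integral `∫₀¹ t^{-1/2} dt = 2` -/

/-- `∫₀¹ t^{-1/2} dt = 2`, in `ℝ≥0∞` form. [folklore] -/
theorem lintegral_Ioc_rpow_neg_half :
    ∫⁻ t in Ioc (0 : ℝ) 1, ENNReal.ofReal (t ^ (-(2 : ℝ)⁻¹)) = 2 := by
  have hr : (-1 : ℝ) < -(2 : ℝ)⁻¹ := by norm_num
  have hint : IntegrableOn (fun t : ℝ => t ^ (-(2 : ℝ)⁻¹)) (Ioc 0 1) volume :=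
    (intervalIntegrable_iff_integrableOn_Ioc_of_le zero_le_one).1
      (intervalIntegral.intervalIntegrable_rpow' hr)
  have hnn : 0 ≤ᵐ[volume.restrict (Ioc (0 : ℝ) 1)] fun t : ℝ => t ^ (-(2 : ℝ)⁻¹) := by
    filter_upwards [ae_restrict_mem measurableSet_Ioc] with t ht
    exact Real.rpow_nonneg ht.1.le _
  rw [← ofReal_integral_eq_lintegral_ofReal hint hnn, ← integral_of_le zero_le_one,
    integral_rpow (Or.inl hr)]
  norm_num

/-! ## Cauchy–Schwarz in `t` -/

/-- **Cauchy–Schwarz in `t` with the weights `t^{∓1/4}`**: for every `x`,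
`(∫₀¹ ‖t f(tx) × x‖ dt)² ≤ 2 ∫₀¹ t^{1/2} · t² ‖x‖² ‖f(tx)‖² dt`. [folklore] -/
theorem lintegral_enorm_coneIntegrand_sq_le {f : ℝ³ → ℝ³} {x : ℝ³}
    (hx : AEStronglyMeasurable (fun t : ℝ => f (t • x)) (volume.restrict (Ioc (0 : ℝ) 1))) :
    (∫⁻ t in Ioc (0 : ℝ) 1, ‖coneIntegrand f t x‖ₑ) ^ 2 ≤
      2 * ∫⁻ t in Ioc (0 : ℝ) 1, ENNReal.ofReal (t ^ (2 : ℝ)⁻¹) *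
        ((ENNReal.ofReal t) ^ 2 * (‖x‖ₑ ^ 2 * ‖f (t • x)‖ₑ ^ 2)) := by
  -- the two factors
  set a : ℝ → ℝ≥0∞ := fun t => ENNReal.ofReal (t ^ (-(4 : ℝ)⁻¹)) with ha
  set b : ℝ → ℝ≥0∞ := fun t => ENNReal.ofReal (t ^ (4 : ℝ)⁻¹) *
    (ENNReal.ofReal t * (‖x‖ₑ * ‖f (t • x)‖ₑ)) with hb
  have hab : ∀ t ∈ Ioc (0 : ℝ) 1, ‖coneIntegrand f t x‖ₑ ≤ (a * b) t := by
    intro t ht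
    have ht0 : 0 < t := ht.1
    have h1 : a t * ENNReal.ofReal (t ^ (4 : ℝ)⁻¹) = 1 := by
      rw [ha, ← ENNReal.ofReal_mul (Real.rpow_nonneg ht0.le _), ← Real.rpow_add ht0]
      norm_num
    have h2 : (a * b) t = ENNReal.ofReal t * (‖x‖ₑ * ‖f (t • x)‖ₑ) := by
      show a t * (ENNReal.ofReal (t ^ (4 : ℝ)⁻¹) * (ENNReal.ofReal t * (‖x‖ₑ * ‖f (t • x)‖ₑ))) = _
      rw [← mul_assoc, h1, one_mul]
    exact (enorm_coneIntegrand_le f ht0.le x).trans_eq h2.symm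
  have ham : AEMeasurable a (volume.restrict (Ioc (0 : ℝ) 1)) :=
    (measurable_id.pow_const _).ennreal_ofReal.aemeasurable
  have hbm : AEMeasurable b (volume.restrict (Ioc (0 : ℝ) 1)) := by
    refine ((measurable_id.pow_const _).ennreal_ofReal.aemeasurable).mul ?_
    exact measurable_id.ennreal_ofReal.aemeasurable.mul (hx.enorm.const_mul _)
  -- Hölder with `p = q = 2`
  have hCS := ENNReal.lintegral_mul_le_Lp_mul_Lq (volume.restrict (Ioc (0 : ℝ) 1))
    Real.HolderConjugate.two_two ham hbm
  have hmono : ∫⁻ t in Ioc (0 : ℝ) 1, ‖coneIntegrand f t x‖ₑ ≤ ∫⁻ t in Ioc (0 : ℝ) 1, (a * b) t :=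
    setLIntegral_mono' measurableSet_Ioc hab
  -- squares of the factors
  have ha2 : ∫⁻ t in Ioc (0 : ℝ) 1, a t ^ (2 : ℝ) = 2 := by
    rw [← lintegral_Ioc_rpow_neg_half]
    refine setLIntegral_congr_fun measurableSet_Ioc fun t ht => ?_
    rw [ha]
    dsimp only
    rw [ENNReal.ofReal_rpow_of_pos (Real.rpow_pos_of_pos ht.1 _), ← Real.rpow_mul ht.1.le]
    norm_num
  have hb2 : ∫⁻ t in Ioc (0 : ℝ) 1, b t ^ (2 : ℝ) = ∫⁻ t in Ioc (0 : ℝ) 1,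
      ENNReal.ofReal (t ^ (2 : ℝ)⁻¹) * ((ENNReal.ofReal t) ^ 2 * (‖x‖ₑ ^ 2 * ‖f (t • x)‖ₑ ^ 2)) := by
    refine setLIntegral_congr_fun measurableSet_Ioc fun t ht => ?_
    rw [hb]
    dsimp only
    rw [show (2 : ℝ) = ((2 : ℕ) : ℝ) by norm_num, ENNReal.rpow_natCast, mul_pow, mul_pow, mul_pow,
      ← ENNReal.ofReal_pow (Real.rpow_nonneg ht.1.le _), ← Real.rpow_natCast,
      ← Real.rpow_mul ht.1.le]
    norm_num
  calc (∫⁻ t in Ioc (0 : ℝ) 1, ‖coneIntegrand f t x‖ₑ) ^ 2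
      ≤ (∫⁻ t in Ioc (0 : ℝ) 1, (a * b) t) ^ 2 := pow_le_pow_left' hmono 2
    _ ≤ ((∫⁻ t in Ioc (0 : ℝ) 1, a t ^ (2 : ℝ)) ^ (1 / (2 : ℝ)) *
          (∫⁻ t in Ioc (0 : ℝ) 1, b t ^ (2 : ℝ)) ^ (1 / (2 : ℝ))) ^ 2 := pow_le_pow_left' hCS 2
    _ = (∫⁻ t in Ioc (0 : ℝ) 1, a t ^ (2 : ℝ)) * ∫⁻ t in Ioc (0 : ℝ) 1, b t ^ (2 : ℝ) := by
          have hsq : ∀ Z : ℝ≥0∞, (Z ^ (1 / (2 : ℝ))) ^ 2 = Z := fun Z => by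
            rw [← ENNReal.rpow_natCast, ← ENNReal.rpow_mul]
            norm_num
          rw [mul_pow, hsq, hsq]
    _ = 2 * ∫⁻ t in Ioc (0 : ℝ) 1, ENNReal.ofReal (t ^ (2 : ℝ)⁻¹) *
          ((ENNReal.ofReal t) ^ 2 * (‖x‖ₑ ^ 2 * ‖f (t • x)‖ₑ ^ 2)) := by rw [ha2, hb2]

/-! ## The `L²(B_R)` bound -/

/-- The spatial factor: for `0 < t ≤ 1`,
`t^{1/2} t² ∫_{B_R} ‖x‖² ‖f(tx)‖² dx ≤ R² t^{-1/2} ∫_{B_R} ‖f‖²` (scaling `x = y/t` and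
`B_{tR} ⊆ B_R`). [cite: BradshawTsai2019, (3.6)] -/
theorem lintegral_ball_weight_comp_smul_le (f : ℝ³ → ℝ³) {t : ℝ} (ht : t ∈ Ioc (0 : ℝ) 1)
    {R : ℝ} (hR : 0 ≤ R) :
    ENNReal.ofReal (t ^ (2 : ℝ)⁻¹) * ((ENNReal.ofReal t) ^ 2 *
        ∫⁻ x in ball (0 : ℝ³) R, ‖x‖ₑ ^ 2 * ‖f (t • x)‖ₑ ^ 2) ≤
      ENNReal.ofReal (R ^ 2) * ENNReal.ofReal (t ^ (-(2 : ℝ)⁻¹)) *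
        ∫⁻ x in ball (0 : ℝ³) R, ‖f x‖ₑ ^ 2 := by
  have ht0 : 0 < t := ht.1
  -- `‖x‖² ≤ R²` on the ball
  have h1 : ∫⁻ x in ball (0 : ℝ³) R, ‖x‖ₑ ^ 2 * ‖f (t • x)‖ₑ ^ 2 ≤
      ENNReal.ofReal (R ^ 2) * ∫⁻ x in ball (0 : ℝ³) R, ‖f (t • x)‖ₑ ^ 2 := by
    rw [← lintegral_const_mul' _ _ ENNReal.ofReal_ne_top]
    refine setLIntegral_mono' measurableSet_ball fun x hx => ?_
    refine mul_le_mul_left ?_ _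
    rw [← ofReal_norm, ← ENNReal.ofReal_pow (norm_nonneg _)]
    exact ENNReal.ofReal_le_ofReal (pow_le_pow_left₀ (norm_nonneg _) (mem_ball_zero_iff.1 hx).le 2)
  -- scaling and monotonicity of balls
  have h2 : ∫⁻ x in ball (0 : ℝ³) R, ‖f (t • x)‖ₑ ^ 2 ≤
      ENNReal.ofReal ((t ^ 3)⁻¹) * ∫⁻ x in ball (0 : ℝ³) R, ‖f x‖ₑ ^ 2 := by
    rw [lintegral_ball_comp_smul (fun x => ‖f x‖ₑ ^ 2) ht0 R]
    refine mul_le_mul_right (lintegral_mono_set (ball_subset_ball ?_)) _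
    exact mul_le_of_le_one_left hR ht.2
  -- combine the scalar factors
  have h3 : ENNReal.ofReal (t ^ (2 : ℝ)⁻¹) * ((ENNReal.ofReal t) ^ 2 *
      (ENNReal.ofReal (R ^ 2) * (ENNReal.ofReal ((t ^ 3)⁻¹) *
        ∫⁻ x in ball (0 : ℝ³) R, ‖f x‖ₑ ^ 2))) =
      ENNReal.ofReal (R ^ 2) * ENNReal.ofReal (t ^ (-(2 : ℝ)⁻¹)) *
        ∫⁻ x in ball (0 : ℝ³) R, ‖f x‖ₑ ^ 2 := by
    have hsc : ENNReal.ofReal (t ^ (2 : ℝ)⁻¹) * (ENNReal.ofReal t) ^ 2 * ENNReal.ofReal ((t ^ 3)⁻¹) =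
        ENNReal.ofReal (t ^ (-(2 : ℝ)⁻¹)) := by
      rw [← ENNReal.ofReal_pow ht0.le, ← ENNReal.ofReal_mul (Real.rpow_nonneg ht0.le _),
        ← ENNReal.ofReal_mul (by positivity)]
      congr 1
      rw [← Real.rpow_natCast t 2, ← Real.rpow_natCast t 3, ← Real.rpow_neg ht0.le,
        ← Real.rpow_add ht0, ← Real.rpow_add ht0]
      norm_num
    rw [← hsc]
    ring
  calc ENNReal.ofReal (t ^ (2 : ℝ)⁻¹) * ((ENNReal.ofReal t) ^ 2 *
        ∫⁻ x in ball (0 : ℝ³) R, ‖x‖ₑ ^ 2 * ‖f (t • x)‖ₑ ^ 2)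
      ≤ ENNReal.ofReal (t ^ (2 : ℝ)⁻¹) * ((ENNReal.ofReal t) ^ 2 *
          (ENNReal.ofReal (R ^ 2) * (ENNReal.ofReal ((t ^ 3)⁻¹) *
            ∫⁻ x in ball (0 : ℝ³) R, ‖f x‖ₑ ^ 2))) := by
        gcongr
        exact h1.trans (mul_le_mul_right h2 _)
    _ = _ := h3

/-- **The `L²(B_R)` bound for the cone majorant**: for a.e.-strongly measurable `f : ℝ³ → ℝ³` and
`R ≥ 0`, `∫_{B_R} (∫₀¹ ‖t f(tx) × x‖ dt)² dx ≤ 4 R² ∫_{B_R} ‖f‖²` (Cauchy–Schwarz in `t` with the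
weights `t^{∓1/4}`, Tonelli, scaling). [folklore] -/
theorem lintegral_ball_coneMajorant_sq_le {f : ℝ³ → ℝ³} (hf : AEStronglyMeasurable f volume)
    {R : ℝ} (hR : 0 ≤ R) :
    ∫⁻ x in ball (0 : ℝ³) R, (∫⁻ t in Ioc (0 : ℝ) 1, ‖coneIntegrand f t x‖ₑ) ^ 2 ≤
      4 * ENNReal.ofReal (R ^ 2) * ∫⁻ x in ball (0 : ℝ³) R, ‖f x‖ₑ ^ 2 := by
  set μT : Measure ℝ := volume.restrict (Ioc (0 : ℝ) 1) with hμT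
  have hjoint := aestronglyMeasurable_comp_smul_prod_Ioc hf
  -- the weighted integrand on the product
  set W : ℝ → ℝ³ → ℝ≥0∞ := fun t x => ENNReal.ofReal (t ^ (2 : ℝ)⁻¹) *
    ((ENNReal.ofReal t) ^ 2 * (‖x‖ₑ ^ 2 * ‖f (t • x)‖ₑ ^ 2)) with hW
  have hWm : AEMeasurable (uncurry W) (μT.prod (volume : Measure ℝ³)) := by
    have h1 : AEMeasurable (fun p : ℝ × ℝ³ => ‖f (p.1 • p.2)‖ₑ ^ 2) (μT.prod volume) :=
      hjoint.enorm.pow_const 2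
    have h2 : Measurable fun p : ℝ × ℝ³ => ENNReal.ofReal (p.1 ^ (2 : ℝ)⁻¹) *
        ((ENNReal.ofReal p.1) ^ 2 * ‖p.2‖ₑ ^ 2) :=
      (measurable_fst.pow_const _).ennreal_ofReal.mul
        ((measurable_fst.ennreal_ofReal.pow_const 2).mul (measurable_snd.enorm.pow_const 2))
    refine (h2.aemeasurable.mul h1).congr (Eventually.of_forall fun p => ?_)
    simp only [uncurry, hW, Pi.mul_apply]
    ring
  -- slices are measurable in `t` for a.e. `x`
  have hslice : ∀ᵐ x : ℝ³, AEStronglyMeasurable (fun t : ℝ => f (t • x)) μT :=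
    hjoint.prodMk_right
  -- Step 1: Cauchy–Schwarz in `t`, for a.e. `x`
  have hstep1 : ∫⁻ x in ball (0 : ℝ³) R, (∫⁻ t in Ioc (0 : ℝ) 1, ‖coneIntegrand f t x‖ₑ) ^ 2 ≤
      ∫⁻ x in ball (0 : ℝ³) R, 2 * ∫⁻ t in Ioc (0 : ℝ) 1, W t x := by
    refine lintegral_mono_ae ((ae_restrict_of_ae hslice).mono fun x hx => ?_)
    exact lintegral_enorm_coneIntegrand_sq_le hx
  -- Step 2: Tonelli
  have hstep2 : ∫⁻ x in ball (0 : ℝ³) R, 2 * ∫⁻ t in Ioc (0 : ℝ) 1, W t x =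
      2 * ∫⁻ t in Ioc (0 : ℝ) 1, ∫⁻ x in ball (0 : ℝ³) R, W t x := by
    rw [lintegral_const_mul' _ _ ENNReal.ofNat_ne_top]
    congr 1
    have hWm' : AEMeasurable (uncurry fun x t => W t x)
        ((volume.restrict (ball (0 : ℝ³) R)).prod μT) := by
      exact (hWm.mono_measure (Measure.prod_mono le_rfl
        (Measure.restrict_le_self (s := ball (0 : ℝ³) R)))).prod_swap
    exact lintegral_lintegral_swap hWm'
  -- Step 3: the spatial factor, slice by slice
  have hstep3 : ∫⁻ t in Ioc (0 : ℝ) 1, ∫⁻ x in ball (0 : ℝ³) R, W t x ≤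
      ∫⁻ t in Ioc (0 : ℝ) 1, ENNReal.ofReal (R ^ 2) * ENNReal.ofReal (t ^ (-(2 : ℝ)⁻¹)) *
        ∫⁻ x in ball (0 : ℝ³) R, ‖f x‖ₑ ^ 2 := by
    refine setLIntegral_mono' measurableSet_Ioc fun t ht => ?_
    have hx2 : ∫⁻ x in ball (0 : ℝ³) R, W t x = ENNReal.ofReal (t ^ (2 : ℝ)⁻¹) *
        ((ENNReal.ofReal t) ^ 2 * ∫⁻ x in ball (0 : ℝ³) R, ‖x‖ₑ ^ 2 * ‖f (t • x)‖ₑ ^ 2) := by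
      rw [hW]
      dsimp only
      rw [lintegral_const_mul' _ _ ENNReal.ofReal_ne_top, lintegral_const_mul' _ _ (by simp)]
    rw [hx2]
    exact lintegral_ball_weight_comp_smul_le f ht hR
  -- Step 4: the weight integral
  have hstep4 : ∫⁻ t in Ioc (0 : ℝ) 1, ENNReal.ofReal (R ^ 2) * ENNReal.ofReal (t ^ (-(2 : ℝ)⁻¹)) *
      ∫⁻ x in ball (0 : ℝ³) R, ‖f x‖ₑ ^ 2 =
      ENNReal.ofReal (R ^ 2) * 2 * ∫⁻ x in ball (0 : ℝ³) R, ‖f x‖ₑ ^ 2 := by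
    have h : ∀ t : ℝ, ENNReal.ofReal (R ^ 2) * ENNReal.ofReal (t ^ (-(2 : ℝ)⁻¹)) *
        ∫⁻ x in ball (0 : ℝ³) R, ‖f x‖ₑ ^ 2 =
        (ENNReal.ofReal (R ^ 2) * ∫⁻ x in ball (0 : ℝ³) R, ‖f x‖ₑ ^ 2) *
          ENNReal.ofReal (t ^ (-(2 : ℝ)⁻¹)) := fun t => by ring
    simp_rw [h]
    rw [lintegral_const_mul _ ((measurable_id'.pow_const _).ennreal_ofReal),
      lintegral_Ioc_rpow_neg_half]
    ring
  calc ∫⁻ x in ball (0 : ℝ³) R, (∫⁻ t in Ioc (0 : ℝ) 1, ‖coneIntegrand f t x‖ₑ) ^ 2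
      ≤ ∫⁻ x in ball (0 : ℝ³) R, 2 * ∫⁻ t in Ioc (0 : ℝ) 1, W t x := hstep1
    _ = 2 * ∫⁻ t in Ioc (0 : ℝ) 1, ∫⁻ x in ball (0 : ℝ³) R, W t x := hstep2
    _ ≤ 2 * ∫⁻ t in Ioc (0 : ℝ) 1, ENNReal.ofReal (R ^ 2) * ENNReal.ofReal (t ^ (-(2 : ℝ)⁻¹)) *
          ∫⁻ x in ball (0 : ℝ³) R, ‖f x‖ₑ ^ 2 := mul_le_mul_right hstep3 2
    _ = 2 * (ENNReal.ofReal (R ^ 2) * 2 * ∫⁻ x in ball (0 : ℝ³) R, ‖f x‖ₑ ^ 2) := by rw [hstep4]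
    _ = 4 * ENNReal.ofReal (R ^ 2) * ∫⁻ x in ball (0 : ℝ³) R, ‖f x‖ₑ ^ 2 := by ring

/-- **`∫_{B_R} ‖conePotential f‖² ≤ 4R² ∫_{B_R} ‖f‖²`** for a.e.-strongly measurable `f` and `R ≥ 0`:
the cone potential is bounded on `L²(B_R)` for every ball centred at the origin (a star-shaped
region), with norm `≤ 2R`. [folklore] -/
theorem lintegral_ball_enorm_conePotential_sq_le {f : ℝ³ → ℝ³} (hf : AEStronglyMeasurable f volume)
    {R : ℝ} (hR : 0 ≤ R) :
    ∫⁻ x in ball (0 : ℝ³) R, ‖conePotential f x‖ₑ ^ 2 ≤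
      4 * ENNReal.ofReal (R ^ 2) * ∫⁻ x in ball (0 : ℝ³) R, ‖f x‖ₑ ^ 2 :=
  (lintegral_mono fun x => pow_le_pow_left' (enorm_conePotential_le f x) 2).trans
    (lintegral_ball_coneMajorant_sq_le hf hR)

/-- The cone potential of a field with locally square integrable norm is locally square integrable
(on balls centred at the origin). [folklore] -/
theorem lintegral_ball_enorm_conePotential_sq_lt_top {f : ℝ³ → ℝ³}
    (hf : AEStronglyMeasurable f volume) {R : ℝ}
    (hfR : ∫⁻ x in ball (0 : ℝ³) R, ‖f x‖ₑ ^ 2 < ∞) :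
    ∫⁻ x in ball (0 : ℝ³) R, ‖conePotential f x‖ₑ ^ 2 < ∞ := by
  rcases le_or_gt R 0 with hR | hR
  · rw [Metric.ball_eq_empty.2 hR, Measure.restrict_empty, lintegral_zero_measure]
    exact ENNReal.zero_lt_top
  · refine (lintegral_ball_enorm_conePotential_sq_le hf hR.le).trans_lt ?_
    exact ENNReal.mul_lt_top (ENNReal.mul_lt_top (by simp) ENNReal.ofReal_lt_top) hfR

/-! ## Almost everywhere integrability of the cone integrand; linearity -/

/-- **For `f ∈ L²_loc`, the cone integrand `t ↦ t f(tx) × x` is integrable on `(0, 1]` for a.e. `x`**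
(its `t`-integral has locally square integrable majorant). [folklore] -/
theorem ae_integrableOn_coneIntegrand {f : ℝ³ → ℝ³} (hf : AEStronglyMeasurable f volume)
    (hf2 : ∀ R : ℝ, ∫⁻ x in ball (0 : ℝ³) R, ‖f x‖ₑ ^ 2 < ∞) :
    ∀ᵐ x : ℝ³, IntegrableOn (fun t => coneIntegrand f t x) (Ioc (0 : ℝ) 1) := by
  set μT : Measure ℝ := volume.restrict (Ioc (0 : ℝ) 1) with hμT
  have hjoint := aestronglyMeasurable_coneIntegrand_prod hf
  -- measurability of the slices and of the majorant
  have hsl : ∀ᵐ x : ℝ³, AEStronglyMeasurable (fun t => coneIntegrand f t x) μT :=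
    hjoint.prodMk_right
  have hMm : AEMeasurable (fun x : ℝ³ => ∫⁻ t in Ioc (0 : ℝ) 1, ‖coneIntegrand f t x‖ₑ) volume := by
    have h := (hjoint.enorm.prod_swap : AEMeasurable _ ((volume : Measure ℝ³).prod μT))
    simpa [uncurry] using h.lintegral_prod_right'
  -- finiteness of the majorant a.e. on each ball
  have hball : ∀ n : ℕ, ∀ᵐ x ∂(volume.restrict (ball (0 : ℝ³) (n + 1))),
      (∫⁻ t in Ioc (0 : ℝ) 1, ‖coneIntegrand f t x‖ₑ) ^ 2 < ∞ := by
    intro n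
    refine ae_lt_top' ((hMm.pow_const 2).restrict) ?_
    refine ((lintegral_ball_coneMajorant_sq_le hf (by positivity)).trans_lt ?_).ne
    exact ENNReal.mul_lt_top (ENNReal.mul_lt_top (by simp) ENNReal.ofReal_lt_top) (hf2 _)
  have hall : ∀ᵐ x : ℝ³, (∫⁻ t in Ioc (0 : ℝ) 1, ‖coneIntegrand f t x‖ₑ) ^ 2 < ∞ := by
    have h : ∀ᵐ x ∂(volume.restrict (⋃ n : ℕ, ball (0 : ℝ³) (n + 1))),
        (∫⁻ t in Ioc (0 : ℝ) 1, ‖coneIntegrand f t x‖ₑ) ^ 2 < ∞ :=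
      (ae_restrict_iUnion_iff _ _).2 hball
    rwa [iUnion_ball_nat_succ, Measure.restrict_univ] at h
  filter_upwards [hsl, hall] with x hx1 hx2
  refine ⟨hx1, ?_⟩
  rw [hasFiniteIntegral_iff_enorm]
  exact lt_of_pow_lt_pow_left' 2 (hx2.trans_eq (ENNReal.top_pow two_ne_zero).symm)

/-- The cone integrand is additive in the field. [folklore] -/
theorem coneIntegrand_sub (f g : ℝ³ → ℝ³) (t : ℝ) (x : ℝ³) :
    coneIntegrand (f - g) t x = coneIntegrand f t x - coneIntegrand g t x := by
  have h : cross (f (t • x) - g (t • x)) x = cross (f (t • x)) x - cross (g (t • x)) x := by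
    simp [cross]
  simp only [coneIntegrand_apply, Pi.sub_apply, h, smul_sub]

/-- **Linearity**: `conePotential (f − g) x = conePotential f x − conePotential g x` at every `x` where
both cone integrands are integrable on `(0, 1]` (hence a.e. for `f, g ∈ L²_loc`). [folklore] -/
theorem conePotential_sub {f g : ℝ³ → ℝ³} {x : ℝ³}
    (hf : IntegrableOn (fun t => coneIntegrand f t x) (Ioc (0 : ℝ) 1))
    (hg : IntegrableOn (fun t => coneIntegrand g t x) (Ioc (0 : ℝ) 1)) :
    conePotential (f - g) x = conePotential f x - conePotential g x := by
  simp only [conePotential_eq_setIntegral, coneIntegrand_sub]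
  exact integral_sub hf hg

/-- The cone potential is homogeneous in the field: `conePotential (c • f) = c • conePotential f`
(everywhere, no integrability needed). [folklore] -/
theorem conePotential_const_smul (c : ℝ) (f : ℝ³ → ℝ³) (x : ℝ³) :
    conePotential (c • f) x = c • conePotential f x := by
  simp only [conePotential_eq_setIntegral, ← MeasureTheory.integral_smul]
  refine integral_congr_ae (Eventually.of_forall fun t => ?_)
  have h : cross (c • f (t • x)) x = c • cross (f (t • x)) x := by
    simp [cross]
  simp only [coneIntegrand_apply, Pi.smul_apply, h, smul_comm t c]

/-! ## Measurability of the cone potential -/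

/-- The cone potential of an a.e.-strongly measurable field is a.e.-strongly measurable. [folklore] -/
theorem aestronglyMeasurable_conePotential {f : ℝ³ → ℝ³} (hf : AEStronglyMeasurable f volume) :
    AEStronglyMeasurable (conePotential f) volume := by
  have h := (aestronglyMeasurable_coneIntegrand_prod hf).prod_swap
  have h2 : AEStronglyMeasurable
      (fun x : ℝ³ => ∫ t, (uncurry (coneIntegrand f)) ((x, t) : ℝ³ × ℝ).swap
        ∂(volume.restrict (Ioc (0 : ℝ) 1))) volume :=
    h.integral_prod_right'
  refine h2.congr (Eventually.of_forall fun x => ?_)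
  simp [conePotential_eq_setIntegral, uncurry]

/-! ## Scaling covariance -/

/-- **The cone potential commutes with the DSS scaling**: if `c f(c y) = f(y)` for all `y` (`c ≠ 0`;
a discretely self-similar datum in the sense of Bradshaw–Tsai 2019, §1, pointwise representative)
then `conePotential f (c x) = conePotential f x` — the cone integrands agree pointwise in `t`, since
`f(t c x) = c⁻¹ f(t x)` and the cross product is bilinear. [cite: BradshawTsai2019, Lemma 4.1] -/
theorem conePotential_smul_of_dss {f : ℝ³ → ℝ³} {c : ℝ} (hc : c ≠ 0)
    (hdss : ∀ y : ℝ³, c • f (c • y) = f y) (x : ℝ³) :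
    conePotential f (c • x) = conePotential f x := by
  have hint : ∀ t : ℝ, coneIntegrand f t (c • x) = coneIntegrand f t x := by
    intro t
    have hf : f (c • t • x) = c⁻¹ • f (t • x) := by
      rw [← hdss (t • x), smul_smul c⁻¹ c, inv_mul_cancel₀ hc, one_smul]
    have hcross : ∀ a : ℝ³, cross (c⁻¹ • a) (c • x) = cross a x := fun a => by
      simp [cross, smul_smul, mul_inv_cancel₀ hc]
    rw [coneIntegrand_apply, coneIntegrand_apply, smul_comm t c x, hf, hcross]
  simp only [conePotential, hint]

/-- Iterate along the scaling orbit: `conePotential f (c^i x) = conePotential f x` for every integer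
`i`, under the same DSS hypothesis with `0 < c`. [cite: BradshawTsai2019, Lemma 4.1] -/
theorem conePotential_zpow_smul_of_dss {f : ℝ³ → ℝ³} {c : ℝ} (hc : 0 < c)
    (hdss : ∀ y : ℝ³, c • f (c • y) = f y) (i : ℤ) (x : ℝ³) :
    conePotential f (c ^ i • x) = conePotential f x := by
  have hc0 : c ≠ 0 := hc.ne'
  -- one step up and one step down
  have hup : ∀ y : ℝ³, conePotential f (c • y) = conePotential f y :=
    conePotential_smul_of_dss hc0 hdss
  have hdown : ∀ y : ℝ³, conePotential f (c⁻¹ • y) = conePotential f y := fun y => by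
    rw [← hup (c⁻¹ • y), smul_smul, mul_inv_cancel₀ hc0, one_smul]
  -- natural powers
  have hnat : ∀ n : ℕ, ∀ y : ℝ³, conePotential f (c ^ n • y) = conePotential f y := by
    intro n
    induction n with
    | zero => intro y; simp
    | succ n ih => intro y; rw [pow_succ, mul_smul, ih, hup]
  have hnat' : ∀ n : ℕ, ∀ y : ℝ³, conePotential f ((c ^ n)⁻¹ • y) = conePotential f y := by
    intro n
    induction n with
    | zero => intro y; simp
    | succ n ih => intro y; rw [pow_succ, mul_inv, mul_smul, ih, hdown]
  cases i with
  | ofNat n => simpa using hnat n x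
  | negSucc n => simpa [zpow_negSucc] using hnat' (n + 1) x

end Literature.Analysis.FluidPDE

end
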